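import Summits.HodgeConjecture.HodgeCM.Automorphic.WeilThetaModelHeisenbergWeyl_1

/-! PORT of `HodgeCM/Automorphic/WeilThetaModelHeisenbergWeyl.lean` (HodgeCMPerL run 82) — part 2: continuation of `Summits.HodgeConjecture.HodgeCM.Automorphic.WeilThetaModelHeisenbergWeyl_1` (split at a top-level declaration boundary by port_pkg.py; scope re-opened below; declarations unchanged). -/

-- port_pkg: scope re-opened for this part (file-level context, then the namespace/section stack open at the cut)
set_option autoImplicit false
noncomputable section
open Topology MeasureTheory
open scoped RealInnerProductSpace FourierTransform SchwartzMap
namespace HodgeCM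
namespace SchwartzWeil
section Theta
variable (V : Type) [NormedAddCommGroup V] [InnerProductSpace ℝ V] [FiniteDimensional ℝ V] [MeasurableSpace V]
  [BorelSpace V] (L : Submodule ℤ V) (m : ℤ) (hm : m ≠ 0)
omit [FiniteDimensional ℝ V] [MeasurableSpace V] [BorelSpace V] in
/-- (Ported verbatim from the HodgeCMPerL package; no docstring in the source.) -/
theorem weyl_mem_arithW :
    (SemidirectProduct.inr (Multiplicative.ofAdd 1) : HeisW V m hm) ∈ arithW V L m hm := by
  have h : (SemidirectProduct.inl (1 : Heis V) * SemidirectProduct.inr (Multiplicative.ofAdd 1) : HeisW V m hm) =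
      SemidirectProduct.inr (Multiplicative.ofAdd 1) := by rw [map_one, one_mul]
  rw [← h]
  exact Subgroup.mem_sup_right (Subgroup.mem_zpowers _)

variable [DiscreteTopology L] [IsZLattice ℝ L]

/-- **The Weyl element stabilises the theta distribution of a SELF-DUAL lattice** (Poisson summation, #2):
`Σ_L 𝓕Ψ = Σ_L Ψ`. -/
theorem weyl_mem_thetaStab (hL : PoissonSummation.dualLattice L = L) :
    (SemidirectProduct.inr (Multiplicative.ofAdd 1) : HeisW V m hm) ∈ thetaStab V L m hm := fun Ψ => by
  rw [repW_weyl_apply, thetaH_one, thetaH_one, PoissonSummation.tsum_fourier_eq_tsum_of_dualLattice_eq L Ψ hL]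

/-- **Théorème 6 for the extended group** (self-dual `L`): `arithW ≤ stabiliser`. -/
theorem arithW_le_thetaStab (hL : PoissonSummation.dualLattice L = L) :
    arithW V L m hm ≤ thetaStab V L m hm := by
  refine sup_le (Subgroup.map_le_iff_le_comap.mpr fun γ hγ => inl_mem_thetaStab V L m hm hγ) ?_
  rw [Subgroup.zpowers_le, map_one, one_mul]
  exact weyl_mem_thetaStab V L m hm hL

/-- **Left `arithW`-invariance of `Θ̃`** for a self-dual lattice: `Θ̃_Φ(γ x) = Θ̃_Φ(x)`, `γ ∈ ⟨arith, σ⟩`. -/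
theorem thetaW_arithW_mul (hL : PoissonSummation.dualLattice L = L) (Φ : 𝓢(V, ℂ)) {γ : HeisW V m hm}
    (hγ : γ ∈ arithW V L m hm) (x : HeisW V m hm) : thetaW V L m hm Φ (γ * x) = thetaW V L m hm Φ x :=
  thetaW_stab_mul V L m hm Φ (arithW_le_thetaStab V L m hm hL hγ) x

omit [IsZLattice ℝ L] in
/-- Joint continuity of `(Φ, x) ↦ Θ̃_Φ(x)`. -/
theorem continuous_thetaW_uncurry : Continuous (Function.uncurry (thetaW V L m hm)) := by
  have h := (continuous_thetaH_left V L m (1 : Heis V)).comp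
    ((continuous_repW_uncurry V m hm).comp
      ((continuous_snd (X := 𝓢(V, ℂ)) (Y := HeisW V m hm)).prodMk
        (continuous_fst (X := 𝓢(V, ℂ)) (Y := HeisW V m hm))))
  simp only [Function.comp_def, Function.uncurry_def] at h
  exact h

omit [IsZLattice ℝ L] in
/-- (Ported verbatim from the HodgeCMPerL package; no docstring in the source.) -/
theorem continuous_thetaW (Φ : 𝓢(V, ℂ)) : Continuous (thetaW V L m hm Φ) := by
  have h := (continuous_thetaW_uncurry V L m hm).comp
    ((continuous_const (y := Φ)).prodMk (continuous_id (X := HeisW V m hm)))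
  simp only [Function.comp_def, Function.uncurry_def, id] at h
  exact h

omit [IsZLattice ℝ L] in
/-- (Ported verbatim from the HodgeCMPerL package; no docstring in the source.) -/
theorem continuous_thetaW_left (x : HeisW V m hm) : Continuous fun Φ : 𝓢(V, ℂ) => thetaW V L m hm Φ x := by
  have h := (continuous_thetaW_uncurry V L m hm).comp
    ((continuous_id (X := 𝓢(V, ℂ))).prodMk (continuous_const (y := x)))
  simp only [Function.comp_def, Function.uncurry_def, id] at h
  exact h

end Theta

/-! ## Self-dual lattices: the `ℤ`-span of an orthonormal basis -/

namespace SelfDual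

variable {V : Type*} [NormedAddCommGroup V] [InnerProductSpace ℝ V] {ι : Type*} [Fintype ι]

/-- The coordinates of a vector of `span_ℤ(b)` in an orthonormal basis `b` are integers. -/
theorem exists_int_cast_eq_inner_of_mem_span (b : OrthonormalBasis ι ℝ V) {w : V}
    (hw : w ∈ Submodule.span ℤ (Set.range (⇑b))) (i : ι) : ∃ k : ℤ, (k : ℝ) = ⟪w, b i⟫ := by
  classical
  induction hw using Submodule.span_induction with
  | mem x hx =>
    obtain ⟨j, rfl⟩ := hx
    refine ⟨if j = i then 1 else 0, ?_⟩
    rw [orthonormal_iff_ite.mp b.orthonormal j i]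
    split_ifs <;> simp
  | zero => exact ⟨0, by rw [inner_zero_left, Int.cast_zero]⟩
  | add x y _ _ hx hy =>
    obtain ⟨k, hk⟩ := hx
    obtain ⟨l, hl⟩ := hy
    exact ⟨k + l, by rw [inner_add_left, ← hk, ← hl, Int.cast_add]⟩
  | smul a x _ hx =>
    obtain ⟨k, hk⟩ := hx
    exact ⟨a * k, by rw [← Int.cast_smul_eq_zsmul ℝ a x, real_inner_smul_left, ← hk, Int.cast_mul]⟩

/-- **The `ℤ`-span of an orthonormal basis is a self-dual lattice**: `L* = L`. -/
theorem dualLattice_span_orthonormalBasis (b : OrthonormalBasis ι ℝ V) :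
    PoissonSummation.dualLattice (Submodule.span ℤ (Set.range (⇑b))) = Submodule.span ℤ (Set.range (⇑b)) := by
  refine le_antisymm (fun w hw => ?_) (fun w hw => ?_)
  · rw [← b.sum_repr' w]
    refine Submodule.sum_mem _ fun i _ => ?_
    obtain ⟨k, hk⟩ := PoissonSummation.mem_dualLattice.mp hw (b i) (Submodule.subset_span ⟨i, rfl⟩)
    rw [← real_inner_comm (b i) w, ← hk, Int.cast_smul_eq_zsmul ℝ k]
    exact Submodule.smul_mem _ k (Submodule.subset_span ⟨i, rfl⟩)
  · refine PoissonSummation.mem_dualLattice.mpr fun v hv => ?_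
    choose kw hkw using exists_int_cast_eq_inner_of_mem_span b hw
    choose kv hkv using exists_int_cast_eq_inner_of_mem_span b hv
    refine ⟨∑ i, kw i * kv i, ?_⟩
    rw [← b.sum_inner_mul_inner w v, Int.cast_sum]
    refine Finset.sum_congr rfl fun i _ => ?_
    rw [Int.cast_mul, hkw, hkv, real_inner_comm (b i) v]

/-- In particular `ℤⁿ ⊂ ℝⁿ` is self-dual. -/
theorem dualLattice_zn (n : ℕ) :
    PoissonSummation.dualLattice (Submodule.span ℤ (Set.range (PiLp.basisFun 2 ℝ (Fin n)))) =
      Submodule.span ℤ (Set.range (PiLp.basisFun 2 ℝ (Fin n))) := by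
  rw [← EuclideanSpace.basisFun_toBasis, OrthonormalBasis.coe_toBasis]
  exact dualLattice_span_orthonormalBasis (EuclideanSpace.basisFun (Fin n) ℝ)

end SelfDual

/-! ## The Weil theta model on the extended group -/

section Model

variable (V : Type) [NormedAddCommGroup V] [InnerProductSpace ℝ V] [FiniteDimensional ℝ V] [MeasurableSpace V]
  [BorelSpace V] (L : Submodule ℤ V) (m : ℤ) (hm : m ≠ 0)

namespace HeisW

/-- The splitting `(x, z) ↦ x · c(z)` of `HeisW × U(1)` into `HeisW` (a homomorphism: `c(z)` is central). -/
def splitting : HeisW V m hm × Circle →* HeisW V m hm :=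
  MonoidHom.mk' (fun p => p.1 * center p.2) (by
    intro p q
    simp only [Prod.fst_mul, Prod.snd_mul, map_mul]
    rw [mul_assoc, mul_assoc, ← mul_assoc (center p.2), center_mul_comm p.2 q.1, mul_assoc])

omit [FiniteDimensional ℝ V] [MeasurableSpace V] [BorelSpace V] in
/-- (Ported verbatim from the HodgeCMPerL package; no docstring in the source.) -/
@[simp] theorem splitting_apply (p : HeisW V m hm × Circle) : splitting V m hm p = p.1 * center p.2 := rfl

omit [FiniteDimensional ℝ V] [MeasurableSpace V] [BorelSpace V] in
/-- (Ported verbatim from the HodgeCMPerL package; no docstring in the source.) -/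
theorem continuous_splitting : Continuous (splitting V m hm : HeisW V m hm × Circle → HeisW V m hm) :=
  continuous_fst.mul (continuous_center.comp continuous_snd)

end HeisW

omit [FiniteDimensional ℝ V] [MeasurableSpace V] [BorelSpace V] in
/-- (Ported verbatim from the HodgeCMPerL package; no docstring in the source.) -/
theorem center_mem_arithW {z : Circle} (hz : z ^ m = 1) : (HeisW.center z : HeisW V m hm) ∈ arithW V L m hm :=
  inl_mem_arithW V L m hm (center_mem_arith V L m hz)

/-- The datum on the extended group: `Mp := HeisW`, `SX := 𝓢(V, ℂ)`, `act := ρ̃_m`, `rat := arithW`, `theta := Θ̃`. -/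
def datumW : Literature.Theta.WeilThetaDatum.{0} where
  Mp := HeisW V m hm
  SX := 𝓢(V, ℂ)
  act := fun x Φ => (repW V m hm x : 𝓢(V, ℂ) →L[ℂ] 𝓢(V, ℂ)) Φ
  rat := (arithW V L m hm : Set (HeisW V m hm))
  theta := thetaW V L m hm

/-- (Ported verbatim from the HodgeCMPerL package; no docstring in the source.) -/
@[simp] theorem datumW_Mp : (datumW V L m hm).Mp = HeisW V m hm := rfl
/-- (Ported verbatim from the HodgeCMPerL package; no docstring in the source.) -/
@[simp] theorem datumW_SX : (datumW V L m hm).SX = 𝓢(V, ℂ) := rfl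
/-- (Ported verbatim from the HodgeCMPerL package; no docstring in the source.) -/
theorem datumW_act (x : HeisW V m hm) (Φ : 𝓢(V, ℂ)) :
    (datumW V L m hm).act x Φ = (repW V m hm x : 𝓢(V, ℂ) →L[ℂ] 𝓢(V, ℂ)) Φ := rfl
/-- (Ported verbatim from the HodgeCMPerL package; no docstring in the source.) -/
theorem datumW_theta : (datumW V L m hm).theta = thetaW V L m hm := rfl
/-- (Ported verbatim from the HodgeCMPerL package; no docstring in the source.) -/
theorem datumW_rat : (datumW V L m hm).rat = (arithW V L m hm : Set (HeisW V m hm)) := rfl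

/-- (Ported verbatim from the HodgeCMPerL package; no docstring in the source.) -/
theorem actionContinuousW : (datumW V L m hm).ActionContinuous := continuous_repW_uncurry V m hm

variable [DiscreteTopology L] [IsZLattice ℝ L]

/-- (Ported verbatim from the HodgeCMPerL package; no docstring in the source.) -/
theorem thetaContinuousInvariantW (hL : PoissonSummation.dualLattice L = L) :
    (datumW V L m hm).ThetaContinuousInvariant :=
  ⟨continuous_thetaW V L m hm, fun Φ _ hγ x => thetaW_arithW_mul V L m hm hL Φ hγ x⟩

/-- **The Weil theta model on the Heisenberg group WITH THE WEYL ELEMENT ADJOINED.**  For a SELF-DUAL full lattice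
`L ⊂ V`, a weight `m ≠ 0` and a subgroup `Γ ≤ U(1)` of `m`-th roots of unity: prl1-g4's
`WeilThetaModel (Heis V ⋊ ⟨σ⟩) ⟨arith, σ⟩ U(1) Γ` with every field a theorem — the group element `σ` ACTS (by `𝓕`),
and `Θ̃` is invariant under it (Poisson summation). -/
def heisenbergWeylModel (hL : PoissonSummation.dualLattice L = L) (Γ : Subgroup Circle)
    (hΓ : ∀ u ∈ Γ, u ^ m = 1) : HodgeCM.WeilThetaModel (HeisW V m hm) (arithW V L m hm) Circle Γ where
  W := datumW V L m hm
  act_one := repW_one_apply V m hm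
  theta_act := fun Φ x g => thetaW_repW V L m hm Φ x g
  actionContinuous := actionContinuousW V L m hm
  thetaContinuousInvariant := thetaContinuousInvariantW V L m hm hL
  dist_cont := continuous_thetaW_left V L m hm 1
  s := HeisW.splitting V m hm
  s_cont := HeisW.continuous_splitting V m hm
  s_rat := fun _ hγU _ hγ => (arithW V L m hm).mul_mem hγU (center_mem_arithW V L m hm (hΓ _ hγ))
  SK := Set.univ
  SK_stable := fun _ _ _ => Set.mem_univ _

/-- (Ported verbatim from the HodgeCMPerL package; no docstring in the source.) -/
@[simp] theorem heisenbergWeylModel_W (hL : PoissonSummation.dualLattice L = L) (Γ : Subgroup Circle)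
    (hΓ : ∀ u ∈ Γ, u ^ m = 1) : (heisenbergWeylModel V L m hm hL Γ hΓ).W = datumW V L m hm := rfl

/-- (Ported verbatim from the HodgeCMPerL package; no docstring in the source.) -/
@[simp] theorem heisenbergWeylModel_SK (hL : PoissonSummation.dualLattice L = L) (Γ : Subgroup Circle)
    (hΓ : ∀ u ∈ Γ, u ^ m = 1) : (heisenbergWeylModel V L m hm hL Γ hΓ).SK = Set.univ := rfl

/-- The model's theta kernel on representatives: `θ_Φ(x·arithW, zΓ) = Θ̃_Φ(x⁻¹ c(z⁻¹))`. -/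
theorem heisenbergWeylModel_θ_mk (hL : PoissonSummation.dualLattice L = L) (Γ : Subgroup Circle)
    (hΓ : ∀ u ∈ Γ, u ^ m = 1) (Φ : 𝓢(V, ℂ)) (x : HeisW V m hm) (z : Circle) :
    (heisenbergWeylModel V L m hm hL Γ hΓ).θ ⟨Φ, Set.mem_univ Φ⟩ (QuotientGroup.mk x, QuotientGroup.mk z) =
      thetaW V L m hm Φ (x⁻¹ * HeisW.center z⁻¹) := by
  rw [WeilThetaModel.θ_mk]
  rfl

/-- **Consistency with #5**: on the Heisenberg group the new kernel IS the old one. -/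
theorem heisenbergWeylModel_θ_mk_inl (hL : PoissonSummation.dualLattice L = L) (Γ : Subgroup Circle)
    (hΓ : ∀ u ∈ Γ, u ^ m = 1) (Φ : 𝓢(V, ℂ)) (h : Heis V) (z : Circle) :
    (heisenbergWeylModel V L m hm hL Γ hΓ).θ ⟨Φ, Set.mem_univ Φ⟩
        (QuotientGroup.mk (SemidirectProduct.inl h), QuotientGroup.mk z) =
      (heisenbergModel V L m Γ hΓ).θ ⟨Φ, Set.mem_univ Φ⟩ (QuotientGroup.mk h, QuotientGroup.mk z) := by
  rw [heisenbergWeylModel_θ_mk, heisenbergModel_θ_mk, HeisW.center_apply, ← map_inv, ← map_mul, thetaW_inl]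

/-- **The Weyl element is absorbed**: `θ_Φ((σ x)·arithW, q) = θ_Φ(x·arithW, q)` — because `σ ∈ arithW`, i.e. the
functional equation of the theta kernel is now an INVARIANCE of the model (not an external identity). -/
theorem heisenbergWeylModel_θ_weyl_mul (hL : PoissonSummation.dualLattice L = L) (Γ : Subgroup Circle)
    (hΓ : ∀ u ∈ Γ, u ^ m = 1) (Φ : (heisenbergWeylModel V L m hm hL Γ hΓ).SK) (x : HeisW V m hm)
    (q : Circle ⧸ Γ) :
    (heisenbergWeylModel V L m hm hL Γ hΓ).θ Φ
        (QuotientGroup.mk (x * SemidirectProduct.inr (Multiplicative.ofAdd 1)), q) =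
      (heisenbergWeylModel V L m hm hL Γ hΓ).θ Φ (QuotientGroup.mk x, q) := by
  rw [QuotientGroup.mk_mul_of_mem x (weyl_mem_arithW V L m hm)]

/-- `Θ̃_Φ(σ) = Θ_{𝓕Φ}(1) = Θ_Φ(1)`: the theta distribution is fixed by the adjoined Weyl element. -/
theorem thetaW_weyl (hL : PoissonSummation.dualLattice L = L) (Φ : 𝓢(V, ℂ)) :
    thetaW V L m hm Φ (SemidirectProduct.inr (Multiplicative.ofAdd 1)) = thetaW V L m hm Φ 1 := by
  rw [← mul_one (SemidirectProduct.inr (Multiplicative.ofAdd 1) : HeisW V m hm),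
    thetaW_arithW_mul V L m hm hL Φ (weyl_mem_arithW V L m hm)]

/-- Non-degeneracy survives. -/
theorem heisenbergWeylModel_θ_ne_zero (hL : PoissonSummation.dualLattice L = L) (Γ : Subgroup Circle)
    (hΓ : ∀ u ∈ Γ, u ^ m = 1) :
    ∃ Φ : (heisenbergWeylModel V L m hm hL Γ hΓ).SK,
      (heisenbergWeylModel V L m hm hL Γ hΓ).θ Φ (QuotientGroup.mk 1, QuotientGroup.mk 1) ≠ 0 := by
  obtain ⟨Φ, hΦ⟩ := heisenbergModel_θ_ne_zero V L m Γ hΓ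
  refine ⟨⟨Φ.1, Set.mem_univ _⟩, ?_⟩
  have h1 : (1 : HeisW V m hm) = SemidirectProduct.inl 1 := (map_one _).symm
  rw [h1, heisenbergWeylModel_θ_mk_inl]
  exact hΦ

/-- The three structural laws of prl1-g4's record for the extended model. -/
theorem heisenbergWeylModel_structural_laws (hL : PoissonSummation.dualLattice L = L) (Γ : Subgroup Circle)
    (hΓ : ∀ u ∈ Γ, u ^ m = 1) :
    (∀ Φ : (heisenbergWeylModel V L m hm hL Γ hΓ).SK, (heisenbergWeylModel V L m hm hL Γ hΓ).omg 1 Φ = Φ) ∧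
      Continuous (heisenbergWeylModel V L m hm hL Γ hΓ).θ ∧
      ∀ (z : Circle) (Φ : (heisenbergWeylModel V L m hm hL Γ hΓ).SK) (ξ : HeisW V m hm ⧸ arithW V L m hm)
        (q : Circle ⧸ Γ),
        (heisenbergWeylModel V L m hm hL Γ hΓ).θ ((heisenbergWeylModel V L m hm hL Γ hΓ).omg z Φ) (ξ, q) =
          (heisenbergWeylModel V L m hm hL Γ hΓ).θ Φ (ξ, z⁻¹ • q) :=
  (heisenbergWeylModel V L m hm hL Γ hΓ).structural_laws

end Model

/-! ## The standard instance: `V = ℝⁿ`, `L = ℤⁿ` (self-dual), `Γ = ⊥` — no hypotheses left but `m ≠ 0` -/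

section Standard

/-- **The standard extended Heisenberg model** on `Heis ℝⁿ ⋊ ⟨σ⟩`. -/
def heisenbergWeylModelStd (n : ℕ) (m : ℤ) [NeZero m] :
    HodgeCM.WeilThetaModel (HeisW (EuclideanSpace ℝ (Fin n)) m (NeZero.ne m))
      (arithW (EuclideanSpace ℝ (Fin n)) (Submodule.span ℤ (Set.range (PiLp.basisFun 2 ℝ (Fin n)))) m (NeZero.ne m))
      Circle (⊥ : Subgroup Circle) :=
  heisenbergWeylModel (EuclideanSpace ℝ (Fin n)) (Submodule.span ℤ (Set.range (PiLp.basisFun 2 ℝ (Fin n)))) m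
    (NeZero.ne m) (SelfDual.dualLattice_zn n) ⊥ fun u hu => by rw [Subgroup.mem_bot.mp hu, one_zpow]

/-- (Ported verbatim from the HodgeCMPerL package; no docstring in the source.) -/
theorem heisenbergWeylModelStd_θ_ne_zero (n : ℕ) (m : ℤ) [NeZero m] :
    ∃ Φ, (heisenbergWeylModelStd n m).θ Φ (QuotientGroup.mk 1, QuotientGroup.mk 1) ≠ 0 :=
  heisenbergWeylModel_θ_ne_zero _ _ _ _ _ _ _

end Standard

end SchwartzWeil
end HodgeCM

end
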